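import Literature.Topology.FourManifolds.GaussDiagramParity
import Literature.Topology.FourManifolds.RegularProjectionParity
import HarnessLib

/-!
# Gauss diagrams of knots are all-even (Kauffman (1999), §3.2, Lemma 1)

Companion of `Literature.Topology.FourManifolds.GaussDiagramParity`.

`GaussDiagram.AllEven` (defined there) is a **definition** — the decidable predicate "every
chord of `G` is even", i.e. Kauffman's *evenly intersticed* Gauss codes (Kauffman (1999), §3.2,
Definition: "a single component Gauss code `g` is said to be evenly intersticed if there is an
even number of labels in between the two appearances of any label") — and not a named fact:
its type is `GaussDiagram → Prop` (section variable `G`), so there is no proposition `AllEven`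
to discharge, and `∀ G, G.AllEven` is false (`GaussDiagram.not_allEven_ofEquiv_two`: the diagram
of the Gauss code `O1 O2 U1 U2`, two linked chords `0—2` and `1—3`, has two odd chords). The
published result cited on the definition is Kauffman (1999), §3.2, Lemma 1: *if `g` is a single
component planar Gauss code, then `g` is evenly intersticed* ("this follows directly from the
Jordan curve theorem in the plane"; C. F. Gauss, *Werke* VIII, pp. 272, 282–286). That lemma is
**proved** in the tree, by winding numbers, as
`Knot.RegularProjection.overPos_mod_two_ne_underPos_mod_two` (`RegularProjectionParity`). The
present file restates it in the vocabulary of `GaussDiagramParity` and draws the consequences of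
Manturov's projection theorem (`GaussDiagram.evenEquiv_iff_equiv`) for diagrams of knots:

* `Knot.RegularProjection.allEven_diagram`: the Gauss diagram read off a regular projection of a
  knot is all-even (Kauffman (1999), §3.2, Lemma 1), `Knot.HasGaussDiagram.allEven`: so is every
  Gauss diagram of a knot; hence such a diagram is fixed by the deletion of odd chords and is its
  own parity projection (`Knot.HasGaussDiagram.eraseOdd_eq`, `parityProjection_eq`);
* `Knot.HasGaussDiagram.evenEquiv_iff_equiv`: two Gauss diagrams of knots are Reidemeister
  equivalent (through arbitrary, possibly non-realisable, Gauss diagrams) iff they are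
  equivalent through all-even diagrams (Manturov (2012), §3.2, Thm. 2), and, under Reidemeister's
  theorem in Gauss-diagram form (the named fact `Knot.reidemeister`, hypothesis `hR`), two knots
  with Gauss diagrams are isotopic iff their diagrams are equivalent through all-even diagrams
  (`Knot.HasGaussDiagram.isIsotopic_iff_evenEquiv`).

No definition and no named fact is introduced (D-0026).

## References

* L. H. Kauffman, *Virtual knot theory*, European J. Combin. 20 (1999) 663–690, §3.2,
  Definition and Lemma 1 (arXiv:math/9811028, p. 4). [cite: Kauffman1999, §3.2 Lemma 1]
* V. O. Manturov, *Free knots and parity*, in: Introductory Lectures on Knot Theory, Ser. Knots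
  Everything 46, World Scientific (2012) 321–345, §3.1, Thm. 1, §3.2, Thm. 2.
  [cite: Manturov2011, §3.2 Thm. 2]
* C. F. Gauss, *Werke*, Bd. VIII, 272, 282–286.
-/

namespace Literature.Topology.FourManifolds

namespace GaussDiagram

/-- `AllEven` is a genuine condition on a Gauss diagram, not a universally valid statement: the
diagram of the Gauss code `O1 O2 U1 U2` (over-passages at positions `0, 1`, under-passages at
`2, 3`: two linked chords) is not all-even — both its chords are odd. Kauffman (1999), §3.2
(non-planar codes). [folklore] -/
theorem not_allEven_ofEquiv_two :
    ¬ (GaussDiagram.ofEquiv 2 finSumFinEquiv fun _ ↦ 1).AllEven := by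
  decide

end GaussDiagram

namespace Knot

namespace RegularProjection

variable {K : Knot} (P : K.RegularProjection)

/-- **Kauffman (1999), §3.2, Lemma 1** — *a single component planar Gauss code is evenly
intersticed* — in the vocabulary of `GaussDiagramParity`: every chord of the Gauss diagram read
off a regular projection of a knot is even, `GaussDiagram.AllEven`. This is
`overPos_mod_two_ne_underPos_mod_two` (`RegularProjectionParity`, proved there by winding numbers
in place of the Jordan curve theorem); C. F. Gauss, *Werke* VIII, pp. 272, 282–286.
[cite: Kauffman1999, §3.2 Lemma 1] -/
theorem allEven_diagram : P.diagram.AllEven :=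
  fun j ↦ P.overPos_mod_two_ne_underPos_mod_two j

/-- The even chords of the Gauss diagram of a regular projection of a knot are all the chords.
Kauffman (1999), §3.2, Lemma 1. [cite: Kauffman1999, §3.2 Lemma 1] -/
theorem evenChords_diagram : P.diagram.evenChords = Finset.univ :=
  P.diagram.allEven_iff_evenChords_eq_univ.1 P.allEven_diagram

/-- Deleting the odd chords does nothing to the Gauss diagram of a regular projection of a knot
(Manturov's map `f` is the identity on classical knot diagrams). Manturov (2012), §3.1, Thm. 1,
with Kauffman (1999), §3.2, Lemma 1. [cite: Manturov2011, §3.1 Thm. 1] -/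
theorem eraseOdd_diagram : P.diagram.eraseOdd = P.diagram :=
  P.diagram.eraseOdd_eq_self P.allEven_diagram

end RegularProjection

namespace HasGaussDiagram

variable {K K' : Knot} {G G' : GaussDiagram}

/-- **A Gauss diagram of a knot is all-even** (evenly intersticed): Kauffman (1999), §3.2,
Lemma 1, read through `Knot.HasGaussDiagram`. [cite: Kauffman1999, §3.2 Lemma 1] -/
theorem allEven (h : K.HasGaussDiagram G) : G.AllEven := by
  obtain ⟨P, rfl⟩ := h
  exact P.allEven_diagram

/-- The even chords of a Gauss diagram of a knot are all the chords. Kauffman (1999), §3.2,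
Lemma 1. [cite: Kauffman1999, §3.2 Lemma 1] -/
theorem evenChords_eq_univ (h : K.HasGaussDiagram G) : G.evenChords = Finset.univ :=
  G.allEven_iff_evenChords_eq_univ.1 h.allEven

/-- **Deleting the odd chords does nothing to a Gauss diagram of a knot** (Manturov's map `f`
is the identity on classical knot diagrams). Manturov (2012), §3.1, Thm. 1, with Kauffman
(1999), §3.2, Lemma 1. [cite: Manturov2011, §3.1 Thm. 1] -/
theorem eraseOdd_eq (h : K.HasGaussDiagram G) : G.eraseOdd = G :=
  G.eraseOdd_eq_self h.allEven

/-- A Gauss diagram of a knot is its own parity projection. Manturov (2012), §3.2 (the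
projection to `𝔙¹`), with Kauffman (1999), §3.2, Lemma 1. [cite: Manturov2011, §3.2 Thm. 2] -/
theorem parityProjection_eq (h : K.HasGaussDiagram G) : G.parityProjection = G :=
  G.parityProjection_eq_self h.allEven

/-- **Manturov's projection theorem for diagrams of knots**: two Gauss diagrams of knots are
Reidemeister equivalent (through arbitrary, possibly non-realisable, Gauss diagrams) iff they
are equivalent through Gauss diagrams all of whose chords are even. Manturov (2012), §3.2,
Thm. 2 (`GaussDiagram.evenEquiv_iff_equiv`) with Kauffman (1999), §3.2, Lemma 1.
[cite: Manturov2011, §3.2 Thm. 2] -/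
theorem evenEquiv_iff_equiv (h : K.HasGaussDiagram G) (h' : K'.HasGaussDiagram G') :
    GaussDiagram.EvenEquiv G G' ↔ G.Equiv G' :=
  GaussDiagram.evenEquiv_iff_equiv h.allEven h'.allEven

/-- Reidemeister equivalent Gauss diagrams of knots are equivalent through all-even diagrams.
Manturov (2012), §3.2, Thm. 2. [cite: Manturov2011, §3.2 Thm. 2] -/
theorem evenEquiv_of_equiv (h : K.HasGaussDiagram G) (h' : K'.HasGaussDiagram G')
    (he : G.Equiv G') : GaussDiagram.EvenEquiv G G' :=
  GaussDiagram.evenEquiv_of_equiv h.allEven h'.allEven he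

/-- **Isotopic knots have Gauss diagrams related through all-even diagrams**: under
Reidemeister's theorem in Gauss-diagram form (the named fact `Knot.reidemeister`, hypothesis
`hR`), two knots with Gauss diagrams `G`, `G'` are isotopic iff `G` and `G'` are equivalent
through Gauss diagrams all of whose chords are even. Manturov (2012), §3.2, Thm. 2, combined
with Reidemeister (1927) / Goussarov–Polyak–Viro (2000), Thm. 1.B. [cite: Manturov2011, §3.2 Thm. 2] -/
theorem isIsotopic_iff_evenEquiv (hR : Knot.reidemeister) (h : K.HasGaussDiagram G)
    (h' : K'.HasGaussDiagram G') : K.IsIsotopic K' ↔ GaussDiagram.EvenEquiv G G' :=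
  (hR h h').trans (evenEquiv_iff_equiv h h').symm

end HasGaussDiagram

end Knot

end Literature.Topology.FourManifolds
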